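import Summits.QuantumFields.YangMills.Theorems.AllWindowsColdBoxBoxHighLineQuadFormCum3Wick
import Summits.QuantumFields.YangMills.Theorems.AllWindowsColdBoxBoxHighLineQuadFormFluct

/-!
# `ConnectedThreePoint`, quadratic vertices, IN THE CHART: `κ₃⁰(v·Av, v·Bv, v·Mv) = β⁻³·Σ A_{aa'}B_{bb'}M_{cc'}(P⁻¹)_{a'b}(P⁻¹)_{b'c}(P⁻¹)_{c'a}`
# under `exp(−β vᵀPv) dv`, and the cold-box `gaussAvg`/`quadVal` transcription (`P = hodgeQ H ⊗ₖ 1₃`)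

Width seat `ym-line-sfw-p2-w3` (g41), cell ym-idea-1; U5 prep, helper-grade (planner ym-idea-2 g18 BOARD 2026-08-29T22:22:10Z, lift L2 of U5-BLOCKERS §2).
Companion of ✓`…QuadFormCum3Wick` (process level: `QuadCum3.cum3_quadForm_eq_symm`, the eight connected pairings).  Here:

* `GaussianChartWick.integral_mul_exp_quadForm_eq_integral_legs` — the one-line transfer of ANY integrand from `exp(−β vᵀPv) dv` on `ι → ℝ`
  (`P` positive definite on a finite index type) to the probability space of LEAD's legs process (✓`isGaussianProcess_legs`): reindex along
  `Fintype.equivFin ι` (✓`integral_comp_equivFin`), write `P' = RᵀR` (✓`exists_transpose_mul_self_of_posDef`), push forward (✓`integral_mul_exp_eq_integral_pi`);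
  `two_point_legs` — the legs' two-point function is `(2β)⁻¹·(P⁻¹)_{ij}`;
* ★★ `cum3_quadForm_gauss` — for symmetric `A B M : Matrix ι ι ℝ`, with `E₀[F] := (∫ F e^{−βvᵀPv})/(∫ e^{−βvᵀPv})`:
  `E₀[Q_AQ_BQ_M] − E₀[Q_A]E₀[Q_BQ_M] − E₀[Q_B]E₀[Q_AQ_M] − E₀[Q_M]E₀[Q_AQ_B] + 2E₀[Q_A]E₀[Q_B]E₀[Q_M]
     = β⁻³ · Σ_{aa'bb'cc'} A_{aa'}B_{bb'}M_{cc'}·(P⁻¹)_{a'b}(P⁻¹)_{b'c}(P⁻¹)_{c'a}`   (`Q_A = v·Av`; `8·(2β)⁻³ = β⁻³`; `= β⁻³·tr(AP⁻¹BP⁻¹MP⁻¹)`);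
* ★★ `gaussCum3_quadVal` — the same in the task letters of ✓`Step2Wick`/✓`QuadFormFluct`: for symmetric `A B M` on `LandauFree H × Fin 3` and `β > 0`,
  `κ₃^{gaussAvg β H}(quadVal A, quadVal B, quadVal M) = β⁻³·Σ A_{aa'}B_{bb'}M_{cc'}·G_{a'b}G_{b'c}G_{c'a}`, `G = (hodgeQ H ⊗ₖ 1₃)⁻¹`
  (colour-diagonal: `G_{(e,c),(e',c')} = [c = c']·((hodgeQ H)⁻¹)_{ee'}`, ✓`EdgeChartGaussian.kronecker_one_inv_apply`).
This is the exact Wick value the L2 lift substitutes for the Cauchy–Schwarz size of the even×even×(quadratic vertex) part of `f′(0)` in ASSEMBLY-S5 (e4)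
(ghost form `quadVal M_H`, whose kernel decay is ✓`GhostFP.abs_ghostM_le`; Haar `Σ‖a_e‖² = quadVal 1`).  Not in this file: the quartic vertices
(`W₄`, `Φ⁴`), the plaquette observables' own quartic parts, the `1_D` truncation transfer and the two-propagator lattice sums.

Tree + Mathlib only; no definitions; standard axioms.  HONEST LABEL: a tool for the RECORDED lift L2 of the NEXT rung U5 (⟨stmt-QuantumFields-24336⟩,
UNSTAFFED); ⟨24004⟩ ⟨24336⟩ remain OPEN; route AllWindowsColdBox is DRAFT; no crux, rung or summit is proved; **the Yang–Mills mass gap is NOT proved by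
this file; no summit is proved by a line.**
-/

set_option autoImplicit false

noncomputable section

open MeasureTheory ProbabilityTheory Matrix Finset
open scoped Kronecker

namespace Summit.QuantumFields.YangMills.Theorems.AllWindowsColdBoxBoxHighLine

namespace GaussianChartWick

variable {ι : Type*} [Fintype ι] [DecidableEq ι]

omit [DecidableEq ι] in
/-- **Transfer of any integrand to the legs process.**  For a positive-definite `P` on a finite index type there are an invertible `R` on
`Fin |ι|` with `RᵀR = P.submatrix e⁻¹ e⁻¹` (`e = Fintype.equivFin ι`) such that for EVERY `F`,
`∫ F(v) e^{−β vᵀPv} dv = √(π/β)^{|ι|}/|det R| · ∫ F((R⁻¹u) ∘ e) dP_β(u)`. -/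
theorem integral_mul_exp_quadForm_eq_integral_legs (P : Matrix ι ι ℝ) (hP : P.PosDef) {β : ℝ} (hβ : 0 < β) :
    ∃ R : Matrix (Fin (Fintype.card ι)) (Fin (Fintype.card ι)) ℝ,
      Rᵀ * R = P.submatrix (Fintype.equivFin ι).symm (Fintype.equivFin ι).symm ∧ R.det ≠ 0 ∧
      ∀ F : (ι → ℝ) → ℝ, ∫ v : ι → ℝ, F v * Real.exp (-(β * (v ⬝ᵥ P *ᵥ v))) =
        Real.sqrt (Real.pi / β) ^ Fintype.card ι / |R.det| *
          ∫ u, F (fun i => (R⁻¹ *ᵥ u) (Fintype.equivFin ι i))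
            ∂(Measure.pi (fun _ : Fin (Fintype.card ι) => gaussianReal 0 (Real.toNNReal (2 * β)⁻¹))) := by
  obtain ⟨R, hRP, hR⟩ := exists_transpose_mul_self_of_posDef _ (posDef_submatrix_equivFin P hP)
  refine ⟨R, hRP, hR, fun F => ?_⟩
  rw [← integral_comp_equivFin]
  simp_rw [quadForm_comp_equivFin P, ← mulVec_dotProduct_mulVec_of_transpose_mul_self hRP]
  exact integral_mul_exp_eq_integral_pi R hR hβ (fun w => F (fun i => w (Fintype.equivFin ι i)))

/-- The two-point function of the transferred legs is `(2β)⁻¹·(P⁻¹)_{ij}`. -/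
theorem two_point_legs (P : Matrix ι ι ℝ) {β : ℝ} (hβ : 0 < β) {R : Matrix (Fin (Fintype.card ι)) (Fin (Fintype.card ι)) ℝ}
    (hRP : Rᵀ * R = P.submatrix (Fintype.equivFin ι).symm (Fintype.equivFin ι).symm) (i j : ι) :
    ∫ u, (Pi.single (Fintype.equivFin ι i) (1 : ℝ) ⬝ᵥ (R⁻¹ *ᵥ u)) * (Pi.single (Fintype.equivFin ι j) (1 : ℝ) ⬝ᵥ (R⁻¹ *ᵥ u))
        ∂(Measure.pi (fun _ : Fin (Fintype.card ι) => gaussianReal 0 (Real.toNNReal (2 * β)⁻¹))) =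
      (2 * β)⁻¹ * P⁻¹ i j := by
  rw [integral_leg_mul_leg R hβ, vecMul_inv_dotProduct_vecMul_inv, hRP, inv_submatrix_equivFin, single_one_dotProduct,
    Matrix.mulVec_single_one]
  simp only [Matrix.submatrix_apply, Equiv.symm_apply_apply, Matrix.col_apply]

omit [DecidableEq ι] in
/-- A quadratic form in the transferred variable, as a double sum of products of two legs. -/
theorem quadForm_legs_eq (A : Matrix ι ι ℝ) (x : ι → ℝ) :
    x ⬝ᵥ (A *ᵥ x) = ∑ a, ∑ a', A a a' * (x a * x a') := by
  simp only [dotProduct, Matrix.mulVec, Finset.mul_sum]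
  exact Finset.sum_congr rfl fun a _ => Finset.sum_congr rfl fun a' _ => by ring

end GaussianChartWick

open GaussianChartWick

/-! ## The third cumulant of three quadratic forms under `exp(−β vᵀPv) dv` -/

section Chart

variable {ι : Type*} [Fintype ι] [DecidableEq ι]

/-- ★★ **`ConnectedThreePoint`, quadratic vertices, in the chart.**  For a positive-definite `P`, `β > 0` and symmetric `A, B, M`, with
`E₀[F] = (∫ F e^{−βvᵀPv} dv)/(∫ e^{−βvᵀPv} dv)`:
`E₀[Q_AQ_BQ_M] − E₀[Q_A]E₀[Q_BQ_M] − E₀[Q_B]E₀[Q_AQ_M] − E₀[Q_M]E₀[Q_AQ_B] + 2E₀[Q_A]E₀[Q_B]E₀[Q_M] = β⁻³·Σ A_{aa'}B_{bb'}M_{cc'}P⁻¹_{a'b}P⁻¹_{b'c}P⁻¹_{c'a}`. -/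
theorem cum3_quadForm_gauss (P : Matrix ι ι ℝ) (hP : P.PosDef) {β : ℝ} (hβ : 0 < β) (A B M : Matrix ι ι ℝ)
    (hA : A.IsSymm) (hB : B.IsSymm) (hM : M.IsSymm) :
    (∫ v : ι → ℝ, (v ⬝ᵥ (A *ᵥ v)) * (v ⬝ᵥ (B *ᵥ v)) * (v ⬝ᵥ (M *ᵥ v)) * Real.exp (-(β * (v ⬝ᵥ P *ᵥ v)))) /
          (∫ v : ι → ℝ, Real.exp (-(β * (v ⬝ᵥ P *ᵥ v)))) -
        (∫ v : ι → ℝ, (v ⬝ᵥ (A *ᵥ v)) * Real.exp (-(β * (v ⬝ᵥ P *ᵥ v)))) / (∫ v : ι → ℝ, Real.exp (-(β * (v ⬝ᵥ P *ᵥ v)))) *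
          ((∫ v : ι → ℝ, (v ⬝ᵥ (B *ᵥ v)) * (v ⬝ᵥ (M *ᵥ v)) * Real.exp (-(β * (v ⬝ᵥ P *ᵥ v)))) /
            (∫ v : ι → ℝ, Real.exp (-(β * (v ⬝ᵥ P *ᵥ v))))) -
        (∫ v : ι → ℝ, (v ⬝ᵥ (B *ᵥ v)) * Real.exp (-(β * (v ⬝ᵥ P *ᵥ v)))) / (∫ v : ι → ℝ, Real.exp (-(β * (v ⬝ᵥ P *ᵥ v)))) *
          ((∫ v : ι → ℝ, (v ⬝ᵥ (A *ᵥ v)) * (v ⬝ᵥ (M *ᵥ v)) * Real.exp (-(β * (v ⬝ᵥ P *ᵥ v)))) /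
            (∫ v : ι → ℝ, Real.exp (-(β * (v ⬝ᵥ P *ᵥ v))))) -
        (∫ v : ι → ℝ, (v ⬝ᵥ (M *ᵥ v)) * Real.exp (-(β * (v ⬝ᵥ P *ᵥ v)))) / (∫ v : ι → ℝ, Real.exp (-(β * (v ⬝ᵥ P *ᵥ v)))) *
          ((∫ v : ι → ℝ, (v ⬝ᵥ (A *ᵥ v)) * (v ⬝ᵥ (B *ᵥ v)) * Real.exp (-(β * (v ⬝ᵥ P *ᵥ v)))) /
            (∫ v : ι → ℝ, Real.exp (-(β * (v ⬝ᵥ P *ᵥ v))))) +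
        2 * ((∫ v : ι → ℝ, (v ⬝ᵥ (A *ᵥ v)) * Real.exp (-(β * (v ⬝ᵥ P *ᵥ v)))) / (∫ v : ι → ℝ, Real.exp (-(β * (v ⬝ᵥ P *ᵥ v)))) *
          ((∫ v : ι → ℝ, (v ⬝ᵥ (B *ᵥ v)) * Real.exp (-(β * (v ⬝ᵥ P *ᵥ v)))) / (∫ v : ι → ℝ, Real.exp (-(β * (v ⬝ᵥ P *ᵥ v))))) *
          ((∫ v : ι → ℝ, (v ⬝ᵥ (M *ᵥ v)) * Real.exp (-(β * (v ⬝ᵥ P *ᵥ v)))) / (∫ v : ι → ℝ, Real.exp (-(β * (v ⬝ᵥ P *ᵥ v)))))) =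
      β⁻¹ ^ 3 * ∑ a, ∑ a', ∑ b, ∑ b', ∑ c, ∑ c', A a a' * B b b' * M c c' * (P⁻¹ a' b * P⁻¹ b' c * P⁻¹ c' a) := by
  obtain ⟨R, hRP, hR, htr⟩ := integral_mul_exp_quadForm_eq_integral_legs P hP hβ
  set e := Fintype.equivFin ι with he
  set μ : Measure (Fin (Fintype.card ι) → ℝ) :=
    Measure.pi (fun _ : Fin (Fintype.card ι) => gaussianReal 0 (Real.toNNReal (2 * β)⁻¹)) with hμ
  set Z : ℝ := Real.sqrt (Real.pi / β) ^ Fintype.card ι / |R.det| with hZ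
  have hZpos : 0 < Z := div_pos (pow_pos (Real.sqrt_pos.mpr (div_pos Real.pi_pos hβ)) _) (abs_pos.mpr hR)
  -- the legs process and the three quadratic forms on its probability space
  set X : (Fin (Fintype.card ι) → ℝ) → (Fin (Fintype.card ι) → ℝ) → ℝ := fun ℓ u => ℓ ⬝ᵥ (R⁻¹ *ᵥ u) with hX
  have hGP : IsGaussianProcess X μ := isGaussianProcess_legs R β
  have h0 : ∀ ℓ, ∫ u, X ℓ u ∂μ = 0 := integral_leg_eq_zero R β
  set t : ι → (Fin (Fintype.card ι) → ℝ) := fun i => Pi.single (e i) (1 : ℝ) with ht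
  have hXt : ∀ i u, X (t i) u = (R⁻¹ *ᵥ u) (e i) := fun i u => by
    simp only [hX, ht, single_one_dotProduct]
  set C : ι → ι → ℝ := fun i j => (2 * β)⁻¹ * P⁻¹ i j with hC
  have hCint : ∀ i j, C i j = ∫ u, X (t i) u * X (t j) u ∂μ := fun i j => (two_point_legs P hβ hRP i j).symm
  set φ : (Fin (Fintype.card ι) → ℝ) → (ι → ℝ) := fun u i => (R⁻¹ *ᵥ u) (e i) with hφ
  have hQ : ∀ (N : Matrix ι ι ℝ) (u : Fin (Fintype.card ι) → ℝ),
      φ u ⬝ᵥ (N *ᵥ φ u) = ∑ a, ∑ a', N a a' * (X (t a) u * X (t a') u) := fun N u => by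
    rw [quadForm_legs_eq]; simp only [hXt]; rfl
  -- every expectation as an integral over the legs' probability space
  have hnorm : ∫ v : ι → ℝ, Real.exp (-(β * (v ⬝ᵥ P *ᵥ v))) = Z := by
    have h := htr (fun _ => 1)
    simp only [one_mul] at h
    rw [h, integral_const, smul_eq_mul, probReal_univ, one_mul, mul_one]
  have hE : ∀ F : (ι → ℝ) → ℝ, (∫ v : ι → ℝ, F v * Real.exp (-(β * (v ⬝ᵥ P *ᵥ v)))) /
      (∫ v : ι → ℝ, Real.exp (-(β * (v ⬝ᵥ P *ᵥ v)))) = ∫ u, F (φ u) ∂μ := fun F => by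
    rw [hnorm, htr F, mul_div_cancel_left₀ _ hZpos.ne']
  rw [hE (fun v => (v ⬝ᵥ (A *ᵥ v)) * (v ⬝ᵥ (B *ᵥ v)) * (v ⬝ᵥ (M *ᵥ v))), hE (fun v => v ⬝ᵥ (A *ᵥ v)),
    hE (fun v => (v ⬝ᵥ (B *ᵥ v)) * (v ⬝ᵥ (M *ᵥ v))), hE (fun v => v ⬝ᵥ (B *ᵥ v)),
    hE (fun v => (v ⬝ᵥ (A *ᵥ v)) * (v ⬝ᵥ (M *ᵥ v))), hE (fun v => v ⬝ᵥ (M *ᵥ v)),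
    hE (fun v => (v ⬝ᵥ (A *ᵥ v)) * (v ⬝ᵥ (B *ᵥ v)))]
  have key := QuadCum3.cum3_quadForm_eq_symm hGP h0 t C hCint (fun a a' => A a a') (fun b b' => B b b') (fun c c' => M c c')
    (fun a a' => (hA.apply a a').symm) (fun b b' => (hB.apply b b').symm) (fun c c' => (hM.apply c c').symm)
    (QA := fun u => φ u ⬝ᵥ (A *ᵥ φ u)) (QB := fun u => φ u ⬝ᵥ (B *ᵥ φ u)) (QM := fun u => φ u ⬝ᵥ (M *ᵥ φ u))
    (hQ A) (hQ B) (hQ M)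
  rw [key]
  simp only [hC, Finset.mul_sum]
  refine Finset.sum_congr rfl fun a _ => Finset.sum_congr rfl fun a' _ => Finset.sum_congr rfl fun b _ =>
    Finset.sum_congr rfl fun b' _ => Finset.sum_congr rfl fun c _ => Finset.sum_congr rfl fun c' _ => ?_
  have h2 : (2 : ℝ) ≠ 0 := two_ne_zero
  field_simp
  ring

end Chart

/-! ## The task letters: `gaussAvg β H` and `quadVal` (cold box, `P = hodgeQ H ⊗ₖ 1₃`) -/

section Task

open QuadFluct (quadVal_eq_flat boxQuadForm_eq_flat)
open LaplaceSandwich (flatten)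

/-- Transfer of a product-type integrand `F(quadVal A, quadVal B, quadVal M)·gaussWeight` to the flat chart. -/
theorem integral_quadVal3_mul_gaussWeight (β : ℝ) (H : ℕ) (A B M : Matrix (LandauFree H × Fin 3) (LandauFree H × Fin 3) ℝ)
    (F : ℝ → ℝ → ℝ → ℝ) :
    ∫ a : LandauFree H → E3, F (quadVal A a) (quadVal B a) (quadVal M a) * gaussWeight β H a =
      ∫ v : LandauFree H × Fin 3 → ℝ, F (v ⬝ᵥ (A *ᵥ v)) (v ⬝ᵥ (B *ᵥ v)) (v ⬝ᵥ (M *ᵥ v)) *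
        Real.exp (-(β * (v ⬝ᵥ ((hodgeQ H ⊗ₖ (1 : Matrix (Fin 3) (Fin 3) ℝ)) *ᵥ v)))) := by
  rw [← EdgeChartGaussian.integral_eq_flat]
  refine integral_congr_ae (Filter.Eventually.of_forall fun a => ?_)
  simp only [quadVal_eq_flat, gaussWeight, boxQuadForm_eq_flat]

/-- ★★ **`ConnectedThreePoint`, quadratic vertices, in the task letters.**  For `β > 0` and symmetric `A, B, M` on `LandauFree H × Fin 3`,
`κ₃^{gaussAvg β H}(quadVal A, quadVal B, quadVal M) = β⁻³·Σ A_{aa'}B_{bb'}M_{cc'}·G_{a'b}G_{b'c}G_{c'a}`, `G = (hodgeQ H ⊗ₖ 1₃)⁻¹`. -/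
theorem gaussCum3_quadVal (H : ℕ) {β : ℝ} (hβ : 0 < β) (A B M : Matrix (LandauFree H × Fin 3) (LandauFree H × Fin 3) ℝ)
    (hA : A.IsSymm) (hB : B.IsSymm) (hM : M.IsSymm) :
    gaussAvg β H (fun a => quadVal A a * quadVal B a * quadVal M a) -
        gaussAvg β H (quadVal A) * gaussAvg β H (fun a => quadVal B a * quadVal M a) -
        gaussAvg β H (quadVal B) * gaussAvg β H (fun a => quadVal A a * quadVal M a) -
        gaussAvg β H (quadVal M) * gaussAvg β H (fun a => quadVal A a * quadVal B a) +
        2 * (gaussAvg β H (quadVal A) * gaussAvg β H (quadVal B) * gaussAvg β H (quadVal M)) =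
      β⁻¹ ^ 3 * ∑ a, ∑ a', ∑ b, ∑ b', ∑ c, ∑ c', A a a' * B b b' * M c c' *
        ((hodgeQ H ⊗ₖ (1 : Matrix (Fin 3) (Fin 3) ℝ))⁻¹ a' b * (hodgeQ H ⊗ₖ (1 : Matrix (Fin 3) (Fin 3) ℝ))⁻¹ b' c *
          (hodgeQ H ⊗ₖ (1 : Matrix (Fin 3) (Fin 3) ℝ))⁻¹ c' a) := by
  set P : Matrix (LandauFree H × Fin 3) (LandauFree H × Fin 3) ℝ := hodgeQ H ⊗ₖ (1 : Matrix (Fin 3) (Fin 3) ℝ) with hPdef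
  have hP : P.PosDef := GaussianChartWick.posDef_kronecker_one _ (hodgeQ_posDef H)
  have h3 := integral_quadVal3_mul_gaussWeight β H A B M (fun x y z => x * y * z)
  have hA1 := integral_quadVal3_mul_gaussWeight β H A B M (fun x _ _ => x)
  have hB1 := integral_quadVal3_mul_gaussWeight β H A B M (fun _ y _ => y)
  have hM1 := integral_quadVal3_mul_gaussWeight β H A B M (fun _ _ z => z)
  have hBM := integral_quadVal3_mul_gaussWeight β H A B M (fun _ y z => y * z)
  have hAM := integral_quadVal3_mul_gaussWeight β H A B M (fun x _ z => x * z)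
  have hAB := integral_quadVal3_mul_gaussWeight β H A B M (fun x y _ => x * y)
  have h0 := integral_quadVal3_mul_gaussWeight β H A B M (fun _ _ _ => 1)
  simp only [one_mul] at h0
  unfold gaussAvg
  beta_reduce
  rw [h3, hA1, hB1, hM1, hBM, hAM, hAB, h0]
  exact cum3_quadForm_gauss P hP hβ A B M hA hB hM

end Task

end Summit.QuantumFields.YangMills.Theorems.AllWindowsColdBoxBoxHighLine

end
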